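import Literature.NumberTheory.Sieve.MaynardTaoOfSiegelWalfisz
import Literature.NumberTheory.Sieve.MaynardSieveLemma52
import Literature.NumberTheory.Sieve.MaynardSieveLemma62
import Literature.NumberTheory.Sieve.MaynardSieveLemma63Sum
import Literature.NumberTheory.Sieve.MaynardSieveYm
import Literature.NumberTheory.Sieve.GoldstonGrahamPintzYildirimLemma3
import Literature.NumberTheory.Sieve.GoldstonGrahamPintzYildirimProofs
import Literature.NumberTheory.LFunctions.SiegelWalfisz
import HarnessLib

/-!
# The Maynard–Tao theorem `liminf (p_{n+m} − p_n) ≪ m³ e^{4m}`: the named fact DISCHARGED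

J. Maynard, *Small gaps between primes*, Ann. of Math. (2) 181 (2015), 383–413 = arXiv:1311.4600,
**Theorem 1.1** (p. 3 of the arXiv text): *Let `m ∈ ℕ`. We have
`liminf_n (p_{n+m} − p_n) ≪ m³ e^{4m}`* (the implied constant absolute), vendored in the tree as the
named fact `Literature.NumberTheory.Sieve.frequently_nth_prime_add_le_maynard_tao` (`ParityWave0.lean`):
`∃ C, ∀ m ≥ 1, ∃ᶠ n, p_{n+m} ≤ p_n + C m³ e^{4m}`.

This leaf file (theorems only; it imports the ends of all the developments involved, which no
single one of them can do) closes the printed proof of §4 (p. 8) inside the tree: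

* **Bombieri–Vinogradov** (level of distribution `θ = 1/2 − ε`): from the Siegel–Walfisz theorem,
  now PROVED (`Literature.NumberTheory.LFunctions.siegel_walfisz_holds`, `LFunctions/SiegelWalfisz.lean`, Montgomery–Vaughan
  Cor. 11.19), through Vaughan's identity and the large sieve
  (`Literature.NumberTheory.Sieve.bombieri_vinogradov_of_siegelWalfisz`, `VaughanMeanValue.lean`);
* **Proposition 4.1** (the sieve asymptotics, Lemmas 5.1–6.3): the `S₁` half
  `Literature.NumberTheory.Sieve.maynard_S1_asymptotic_holds` (`MaynardSieveLemma62.lean`, Lemmas 5.1 + 6.2) and the `S₂` half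
  `maynard_S2_asymptotic_holds` below = `maynard_S2_asymptotic_of` (`MaynardSieveS2.lean`) applied to
  Lemma 5.2 (`Literature.NumberTheory.Sieve.maynard_lemma52_holds`, `MaynardSieveLemma52.lean`), the evaluation of `y^{(m)}`
  (`Literature.NumberTheory.Sieve.maynard_lemma63_ym_of_GGPY`, `MaynardSieveYm.lean`, fed with Lemma 6.1 = GGPY Lemma 4,
  `Literature.GGPY.moebiusSqGSumWeighted_asymptotic_of Literature.GGPY.moebiusSqGSum_asymptotic_holds`,
  `GoldstonGrahamPintzYildirimProofs.lean`/`…Lemma3.lean`) and the smooth sum of Lemma 6.3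
  (`Literature.NumberTheory.Sieve.maynard_lemma63_sum_holds`, `MaynardSieveLemma63Sum.lean`);
* **Proposition 4.2** (`≥ ⌈θ M_k/2⌉` primes infinitely often): for `F = G · 1_{R_k}`, `G ∈ C¹`, from
  Prop. 4.1 (`frequently_card_primes_ge_of_maynardFunctional_smooth_of_asymptotics`,
  `MaynardSieve.lean`), and for square-integrable `F` by `L²` approximation
  (`frequently_card_primes_ge_of_maynardFunctional_of_smooth`, `MaynardTaoL2Reduction.lean`);
* **Proposition 4.3(3)** (`M_k > log k − 2 log log k − 2`): `Literature.NumberTheory.Sieve.exists_maynardFunctional_gt_holds`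
  (`MaynardTaoLargeKProofs.lean`);
* **§4, proof of Theorem 1.1** (the choice `k ≫ m² e^{4m}`, the admissible tuple of `k` consecutive
  primes `> k`, `p_{π(k)+k} ≪ k log k`): `ParityWave0MaynardTaoProofs.lean`, packaged with the two
  reductions above as `Literature.NumberTheory.Sieve.frequently_nth_prime_add_le_maynard_tao_of_siegelWalfisz_of_asymptotics`
  (`MaynardTaoOfSiegelWalfisz.lean`).

Main results: `Literature.NumberTheory.Sieve.maynard_S2_asymptotic_holds`,
`Literature.NumberTheory.Sieve.frequently_card_primes_ge_of_maynardFunctional_smooth_holds`,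
`Literature.NumberTheory.Sieve.frequently_card_primes_ge_of_maynardFunctional_holds` (Maynard's Proposition 4.2, the named
fact of `MaynardTao.lean`), and
`Literature.Parity.frequently_nth_prime_add_le_maynard_tao_holds : Literature.Parity.frequently_nth_prime_add_le_maynard_tao`
(Theorem 1.1).

## References

* J. Maynard, *Small gaps between primes*, Ann. of Math. (2) 181 (2015), 383–413,
  doi:10.4007/annals.2015.181.1.7 = arXiv:1311.4600; Theorem 1.1, Propositions 4.1–4.3 and the
  proof of Theorem 1.1 in §4 (p. 8). [cite: MaynardAnnals2015]
* D. A. Goldston, S. W. Graham, J. Pintz, C. Y. Yıldırım, *Small gaps between products of two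
  primes*, Proc. Lond. Math. Soc. (3) 98 (2009), 741–774, Lemmas 3–4 (Maynard's Lemma 6.1).
  [cite: GoldstonEtAl2008]
* H. L. Montgomery, R. C. Vaughan, *Multiplicative Number Theory I*, Cambridge Stud. Adv. Math. 97
  (2007), Cor. 11.19 (Siegel–Walfisz). [cite: MontgomeryVaughan2007]
-/

namespace Literature.NumberTheory.Sieve

/-- **Maynard 2015, Lemma 6.3** (the `S₂` half of Proposition 4.1) — the named fact
`maynard_S2_asymptotic` (`MaynardSieve.lean`) DISCHARGED: Lemma 5.2 (`maynard_lemma52_holds`), the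
evaluation of `y^{(m)}` from Lemma 6.1 (`maynard_lemma63_ym_of_GGPY` with GGPY's Lemmas 3–4,
`GGPY.moebiusSqGSumWeighted_asymptotic_of GGPY.moebiusSqGSum_asymptotic_holds`) and the smooth sum
(`maynard_lemma63_sum_holds`), assembled by `maynard_S2_asymptotic_of`.
[cite: MaynardAnnals2015, Lemma 6.3] -/
theorem maynard_S2_asymptotic_holds : maynard_S2_asymptotic :=
  maynard_S2_asymptotic_of maynard_lemma52_holds
    (maynard_lemma63_ym_of_GGPY
      (GGPY.moebiusSqGSumWeighted_asymptotic_of GGPY.moebiusSqGSum_asymptotic_holds))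
    maynard_lemma63_sum_holds

/-- **Maynard 2015, Proposition 4.2 for `F = G · 1_{R_k}`, `G ∈ C¹`** — the named fact
`frequently_card_primes_ge_of_maynardFunctional_smooth` (`MaynardSieve.lean`) DISCHARGED, from the
two halves of Proposition 4.1 (`maynard_S1_asymptotic_holds`, `maynard_S2_asymptotic_holds`) by
`frequently_card_primes_ge_of_maynardFunctional_smooth_of_asymptotics` (the positivity argument of
§4, p. 7). [cite: MaynardAnnals2015, Proposition 4.2] -/
theorem frequently_card_primes_ge_of_maynardFunctional_smooth_holds :
    frequently_card_primes_ge_of_maynardFunctional_smooth :=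
  frequently_card_primes_ge_of_maynardFunctional_smooth_of_asymptotics maynard_S1_asymptotic_holds
    maynard_S2_asymptotic_holds

/-- **Maynard 2015, Proposition 4.2** — the named fact `frequently_card_primes_ge_of_maynardFunctional`
(`MaynardTao.lean`, square-integrable `F` supported on `R_k` with `I_k(F) ≠ 0`, `M_k(F) = ∑ J/I`)
DISCHARGED: the smooth case and the `L²` reduction
`frequently_card_primes_ge_of_maynardFunctional_of_smooth` (`MaynardTaoL2Reduction.lean`).
[cite: MaynardAnnals2015, Proposition 4.2] -/
theorem frequently_card_primes_ge_of_maynardFunctional_holds :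
    frequently_card_primes_ge_of_maynardFunctional :=
  frequently_card_primes_ge_of_maynardFunctional_of_smooth
    frequently_card_primes_ge_of_maynardFunctional_smooth_holds

/-- **Maynard 2015, Theorem 1.1 (the Maynard–Tao theorem)** — the named fact
`Parity.frequently_nth_prime_add_le_maynard_tao` (`ParityWave0.lean`) DISCHARGED: there is an
absolute constant `C` such that for every `m ≥ 1`, `p_{n+m} ≤ p_n + C m³ e^{4m}` for infinitely
many `n`. Siegel–Walfisz (`Parity.siegel_walfisz_holds`) ⟹ Bombieri–Vinogradov ⟹ level `1/2 − ε`;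
Proposition 4.1 (`maynard_S1_asymptotic_holds`, `maynard_S2_asymptotic_holds`) ⟹ Proposition 4.2;
Proposition 4.3(3) (`exists_maynardFunctional_gt_holds`); and the assembly of §4 — all through
`Parity.frequently_nth_prime_add_le_maynard_tao_of_siegelWalfisz_of_asymptotics`.
[cite: MaynardAnnals2015, Theorem 1.1 and its proof in §4 (p. 8)] -/
theorem frequently_nth_prime_add_le_maynard_tao_holds :
    Sieve.frequently_nth_prime_add_le_maynard_tao :=
  Sieve.frequently_nth_prime_add_le_maynard_tao_of_siegelWalfisz_of_asymptotics
    LFunctions.siegel_walfisz_holds maynard_S1_asymptotic_holds maynard_S2_asymptotic_holds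

end Literature.NumberTheory.Sieve
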